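import Mathlib.Analysis.SpecialFunctions.Integrals.Basic
import Mathlib.Analysis.SpecialFunctions.Trigonometric.Deriv
import Mathlib.Analysis.SpecialFunctions.Trigonometric.DerivHyp
import Mathlib.MeasureTheory.Integral.IntervalIntegral.FundThmCalculus
import HarnessLib

/-!
# Route SignCone: the explicit kernel `E_χ(x) = (e^{x/2} + e^{-x/2}) χ(|x|)` of the pointwise certificates

Support for the unconditional rungs of `SignConeOscillatory` / `SignConeInequality`
(items stmt-RiemannHypothesis-16302 / 16301): the kernel `E` of the spectral identity
`SignConePointwiseIdentity.lean` is chosen as `E_χ(x) = (e^{x/2} + e^{-x/2}) χ(|x|)` with `χ = 1` on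
`[0, L]` (`L = 2b`) and `χ` continuous piecewise linear on the knots `x_k = L + k h`
(`χ(x_0) = 1`, free values `χ_1, …, χ_{K-1}`, `χ(x_K) = 0`, `χ = 0` beyond): a plateau function plus
hat functions. This file contains

* `plateau`, `hat`, `PWKernel` (rational data `L, h, χ`), `PWKernel.chiR`, `PWKernel.kernelE`;
  continuity, compact support, and `E_χ = e^{x/2} + e^{-x/2}` on `[-L, L]`;
* the antiderivatives `pwS`, `pwT` (`∂ₓ pwS = cosh(x/2) cos(xy)`, `∂ₓ pwT = pwS`) and the segment
  integral `∫_p^q cosh(x/2)(α + βx) cos(xy) dx = [(α+βx) S − β T]_p^q` (`integral_cosh_affine_cos`),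
  from which the sibling file computes the cosine transform of `E_χ` in closed form.

Everything here is elementary calculus; no number theory.
-/

noncomputable section

-- `Summit.RiemannHypothesis.RiemannHypothesis.…` repeats a namespace component by design (D-0017 layout).
set_option linter.dupNamespace false

open Real MeasureTheory Set intervalIntegral

namespace Summit.RiemannHypothesis.RiemannHypothesis.Theorems.SignCone

/-! ## Plateau and hat functions -/

/-- The plateau `1` on `(-∞, L]`, linear down to `0` at `L + h`, `0` after. [folklore] -/
def plateau (L h x : ℝ) : ℝ := max 0 (min 1 ((L + h - x) / h))

/-- The hat of height `1` at `c` with half-width `h`. [folklore] -/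
def hat (c h x : ℝ) : ℝ := max 0 (1 - |x - c| / h)

/-- `plateau` is continuous in `x`. [folklore] -/
theorem continuous_plateau (L h : ℝ) : Continuous (plateau L h) := by
  unfold plateau; fun_prop

/-- `hat` is continuous in `x`. [folklore] -/
theorem continuous_hat (c h : ℝ) : Continuous (hat c h) := by
  unfold hat; fun_prop

variable {L h c x : ℝ}

/-- `plateau = 1` on `(-∞, L]` (`h > 0`). [folklore] -/
theorem plateau_of_le (hh : 0 < h) (hx : x ≤ L) : plateau L h x = 1 := by
  unfold plateau
  have h1 : 1 ≤ (L + h - x) / h := by rw [le_div_iff₀ hh]; linarith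
  rw [min_eq_left h1, max_eq_right zero_le_one]

/-- `plateau = (L + h - x)/h` on `[L, L + h]` (`h > 0`). [folklore] -/
theorem plateau_of_mem (hh : 0 < h) (h1 : L ≤ x) (h2 : x ≤ L + h) :
    plateau L h x = (L + h - x) / h := by
  unfold plateau
  have ha : (L + h - x) / h ≤ 1 := by rw [div_le_iff₀ hh]; linarith
  have hb : 0 ≤ (L + h - x) / h := div_nonneg (by linarith) hh.le
  rw [min_eq_right ha, max_eq_right hb]

/-- `plateau = 0` on `[L + h, ∞)` (`h > 0`). [folklore] -/
theorem plateau_of_ge (hh : 0 < h) (hx : L + h ≤ x) : plateau L h x = 0 := by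
  unfold plateau
  have ha : (L + h - x) / h ≤ 0 := div_nonpos_of_nonpos_of_nonneg (by linarith) hh.le
  rw [min_eq_right (ha.trans zero_le_one), max_eq_left ha]

/-- `hat = 0` off `(c - h, c + h)` (`h > 0`). [folklore] -/
theorem hat_of_le_abs (hh : 0 < h) (hx : h ≤ |x - c|) : hat c h x = 0 := by
  unfold hat
  have : 1 - |x - c| / h ≤ 0 := by rw [sub_nonpos, le_div_iff₀ hh]; linarith
  rw [max_eq_left this]

/-- `hat = (x - (c - h))/h` on `[c - h, c]` (`h > 0`). [folklore] -/
theorem hat_of_mem_left (hh : 0 < h) (h1 : c - h ≤ x) (h2 : x ≤ c) :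
    hat c h x = (x - (c - h)) / h := by
  unfold hat
  rw [abs_of_nonpos (by linarith)]
  have h0 : 0 ≤ 1 - -(x - c) / h := by
    rw [sub_nonneg, div_le_iff₀ hh]; linarith
  rw [max_eq_right h0]
  field_simp
  ring

/-- `hat = ((c + h) - x)/h` on `[c, c + h]` (`h > 0`). [folklore] -/
theorem hat_of_mem_right (hh : 0 < h) (h1 : c ≤ x) (h2 : x ≤ c + h) :
    hat c h x = ((c + h) - x) / h := by
  unfold hat
  rw [abs_of_nonneg (by linarith)]
  have h0 : 0 ≤ 1 - (x - c) / h := by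
    rw [sub_nonneg, div_le_iff₀ hh]; linarith
  rw [max_eq_right h0]
  field_simp
  ring

/-! ## The kernel data and the kernel -/

/-- Rational data of a kernel `E_χ`: the plateau length `L = 2b`, the knot spacing `h`, and the
interior knot values `χ_1, …, χ_{K-1}` (`χ_0 = 1`, `χ_K = 0`). [folklore] -/
structure PWKernel where
  /-- plateau length `L = 2b` -/
  L : ℚ
  /-- knot spacing -/
  h : ℚ
  /-- interior knot values `χ_1, …, χ_{K-1}` -/
  chi : List ℚ

namespace PWKernel

variable (d : PWKernel)

/-- Number of segments `K` beyond the plateau (`K - 1` interior knots). [folklore] -/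
def K : ℕ := d.chi.length + 1

/-- The knot `x_k = L + k h`. [folklore] -/
def knot (k : ℕ) : ℚ := d.L + k * d.h

/-- The interior knot value `χ_k` (`1 ≤ k ≤ K - 1`; zero otherwise). [folklore] -/
def chiAt (k : ℕ) : ℚ := d.chi.getD (k - 1) 0

/-- The profile `χ(x) = plateau(x) + Σ_{k=1}^{K-1} χ_k hat_{x_k}(x)` on `[0, ∞)`. [folklore] -/
def chiR (x : ℝ) : ℝ :=
  plateau d.L d.h x + ∑ k ∈ Finset.Ico 1 d.K, (d.chiAt k : ℝ) * hat (d.knot k) d.h x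

/-- **The kernel** `E_χ(x) = (e^{|x|/2} + e^{-|x|/2}) χ(|x|)`. [folklore] -/
def kernelE (x : ℝ) : ℝ := (Real.exp (|x| / 2) + Real.exp (-(|x| / 2))) * d.chiR |x|

/-- `χ` is continuous. [folklore] -/
theorem continuous_chiR : Continuous d.chiR := by
  unfold chiR
  refine (continuous_plateau _ _).add (continuous_finsetSum _ fun k _ => ?_)
  exact continuous_const.mul (continuous_hat _ _)

/-- `E_χ` is continuous. [folklore] -/
theorem continuous_kernelE : Continuous d.kernelE := by
  unfold kernelE
  exact (by fun_prop : Continuous fun x : ℝ => Real.exp (|x| / 2) + Real.exp (-(|x| / 2))).mul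
    (d.continuous_chiR.comp continuous_abs)

/-- `E_χ` is even. [folklore] -/
theorem kernelE_neg (x : ℝ) : d.kernelE (-x) = d.kernelE x := by
  unfold kernelE; rw [abs_neg]

variable {d}

/-- `χ = 0` on `[x_K, ∞)` (`h > 0`). [folklore] -/
theorem chiR_eq_zero_of_ge (hh : 0 < d.h) {x : ℝ} (hx : (d.knot d.K : ℝ) ≤ x) : d.chiR x = 0 := by
  have hh' : (0 : ℝ) < d.h := by exact_mod_cast hh
  have hK : (1 : ℝ) ≤ d.K := by exact_mod_cast Nat.succ_le_of_lt (Nat.succ_pos _)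
  unfold chiR
  have hx' : (d.L : ℝ) + d.h ≤ x := by
    refine le_trans ?_ hx
    unfold knot; push_cast
    nlinarith
  rw [plateau_of_ge hh' hx', zero_add]
  refine Finset.sum_eq_zero fun k hk => ?_
  rw [Finset.mem_Ico] at hk
  have hk' : (k : ℝ) + 1 ≤ d.K := by exact_mod_cast hk.2
  rw [hat_of_le_abs hh' ?_, mul_zero]
  rw [abs_of_nonneg] <;> unfold knot at hx ⊢ <;> push_cast at hx ⊢ <;> nlinarith

/-- `E_χ = 0` for `|x| ≥ x_K` (`h > 0`). [folklore] -/
theorem kernelE_eq_zero_of_le_abs (hh : 0 < d.h) {x : ℝ} (hx : (d.knot d.K : ℝ) ≤ |x|) :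
    d.kernelE x = 0 := by
  unfold kernelE; rw [chiR_eq_zero_of_ge hh hx, mul_zero]

/-- `E_χ` has compact support (`h > 0`). [folklore] -/
theorem hasCompactSupport_kernelE (hh : 0 < d.h) : HasCompactSupport d.kernelE := by
  refine HasCompactSupport.intro (K := Icc (-(d.knot d.K : ℝ)) (d.knot d.K))
    isCompact_Icc fun x hx => ?_
  refine kernelE_eq_zero_of_le_abs hh (le_of_lt ?_)
  rw [mem_Icc, not_and_or, not_le, not_le] at hx
  rcases hx with h1 | h1
  · calc (d.knot d.K : ℝ) < -x := by linarith
      _ ≤ |x| := neg_le_abs x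
  · exact h1.trans_le (le_abs_self x)

/-- `χ = 1` on `[0, L]` (`h > 0`). [folklore] -/
theorem chiR_eq_one (hh : 0 < d.h) {x : ℝ} (hx : x ≤ d.L) : d.chiR x = 1 := by
  have hh' : (0 : ℝ) < d.h := by exact_mod_cast hh
  unfold chiR
  rw [plateau_of_le hh' hx, add_eq_left]
  refine Finset.sum_eq_zero fun k hk => ?_
  rw [Finset.mem_Ico] at hk
  have hk1 : (1 : ℝ) ≤ k := by exact_mod_cast hk.1
  rw [hat_of_le_abs hh' ?_, mul_zero]
  rw [abs_of_nonpos] <;> unfold knot <;> push_cast <;> nlinarith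

/-- **On the plateau**: `E_χ(x) = e^{x/2} + e^{-x/2}` for `|x| ≤ L` (`h > 0`). [folklore] -/
theorem kernelE_eq_of_abs_le (hh : 0 < d.h) {x : ℝ} (hx : |x| ≤ d.L) :
    d.kernelE x = Real.exp (x / 2) + Real.exp (-(x / 2)) := by
  unfold kernelE
  rw [chiR_eq_one hh hx, mul_one]
  rcases le_or_gt 0 x with h0 | h0
  · rw [abs_of_nonneg h0]
  · rw [abs_of_neg h0, neg_div, neg_neg, add_comm]

/-- On the plateau, interval form: `E_χ = e^{x/2} + e^{-x/2}` on `[-L, L]`. [folklore] -/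
theorem kernelE_eq_on_Icc (hh : 0 < d.h) :
    ∀ x ∈ Icc (-(d.L : ℝ)) d.L, d.kernelE x = Real.exp (x / 2) + Real.exp (-(x / 2)) :=
  fun _ hx => kernelE_eq_of_abs_le hh (abs_le.2 ⟨hx.1, hx.2⟩)

end PWKernel

/-! ## The antiderivatives `S`, `T` and the segment integral -/

/-- `S(x, y) = (½ sinh(x/2) cos(xy) + y cosh(x/2) sin(xy)) / (¼ + y²)`; `∂ₓ S = cosh(x/2) cos(xy)`. [folklore] -/
def pwS (x y : ℝ) : ℝ :=
  (1 / 2 * Real.sinh (x / 2) * Real.cos (x * y) + y * Real.cosh (x / 2) * Real.sin (x * y)) / (1 / 4 + y ^ 2)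

/-- `T(x, y) = ((¼ − y²) cosh(x/2) cos(xy) + y sinh(x/2) sin(xy)) / (¼ + y²)²`; `∂ₓ T = S`. [folklore] -/
def pwT (x y : ℝ) : ℝ :=
  ((1 / 4 - y ^ 2) * Real.cosh (x / 2) * Real.cos (x * y) + y * Real.sinh (x / 2) * Real.sin (x * y)) /
    (1 / 4 + y ^ 2) ^ 2

/-- `¼ + y² > 0`. [folklore] -/
theorem quarter_add_sq_pos (y : ℝ) : 0 < 1 / 4 + y ^ 2 := by positivity

/-- `∂ₓ sinh(x/2) = ½ cosh(x/2)`. [folklore] -/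
theorem hasDerivAt_sinh_half (x : ℝ) :
    HasDerivAt (fun x : ℝ => Real.sinh (x / 2)) (1 / 2 * Real.cosh (x / 2)) x := by
  have h : HasDerivAt (fun x : ℝ => x / 2) (1 / 2) x := (hasDerivAt_id' x).div_const 2
  refine ((Real.hasDerivAt_sinh (x / 2)).comp x h).congr_deriv ?_
  ring

/-- `∂ₓ cosh(x/2) = ½ sinh(x/2)`. [folklore] -/
theorem hasDerivAt_cosh_half (x : ℝ) :
    HasDerivAt (fun x : ℝ => Real.cosh (x / 2)) (1 / 2 * Real.sinh (x / 2)) x := by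
  have h : HasDerivAt (fun x : ℝ => x / 2) (1 / 2) x := (hasDerivAt_id' x).div_const 2
  refine ((Real.hasDerivAt_cosh (x / 2)).comp x h).congr_deriv ?_
  ring

/-- `∂ₓ cos(xy) = −y sin(xy)`. [folklore] -/
theorem hasDerivAt_cos_mul (x y : ℝ) :
    HasDerivAt (fun x : ℝ => Real.cos (x * y)) (-(y * Real.sin (x * y))) x := by
  have h : HasDerivAt (fun x : ℝ => x * y) (1 * y) x := (hasDerivAt_id' x).mul_const y
  refine ((Real.hasDerivAt_cos (x * y)).comp x h).congr_deriv ?_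
  ring

/-- `∂ₓ sin(xy) = y cos(xy)`. [folklore] -/
theorem hasDerivAt_sin_mul (x y : ℝ) :
    HasDerivAt (fun x : ℝ => Real.sin (x * y)) (y * Real.cos (x * y)) x := by
  have h : HasDerivAt (fun x : ℝ => x * y) (1 * y) x := (hasDerivAt_id' x).mul_const y
  refine ((Real.hasDerivAt_sin (x * y)).comp x h).congr_deriv ?_
  ring

/-- **`∂ₓ S = cosh(x/2) cos(xy)`.** [folklore] -/
theorem hasDerivAt_pwS (x y : ℝ) :
    HasDerivAt (fun x => pwS x y) (Real.cosh (x / 2) * Real.cos (x * y)) x := by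
  have hD := quarter_add_sq_pos y
  have h := ((((hasDerivAt_sinh_half x).const_mul (1 / 2)).mul (hasDerivAt_cos_mul x y)).add
    (((hasDerivAt_cosh_half x).const_mul y).mul (hasDerivAt_sin_mul x y))).div_const (1 / 4 + y ^ 2)
  refine h.congr_deriv ?_
  rw [div_eq_iff hD.ne']
  ring

/-- **`∂ₓ T = S`.** [folklore] -/
theorem hasDerivAt_pwT (x y : ℝ) : HasDerivAt (fun x => pwT x y) (pwS x y) x := by
  have hD := quarter_add_sq_pos y
  have h := ((((hasDerivAt_cosh_half x).const_mul (1 / 4 - y ^ 2)).mul (hasDerivAt_cos_mul x y)).add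
    (((hasDerivAt_sinh_half x).const_mul y).mul (hasDerivAt_sin_mul x y))).div_const ((1 / 4 + y ^ 2) ^ 2)
  refine h.congr_deriv ?_
  unfold pwS
  rw [div_eq_div_iff (by positivity) hD.ne']
  ring

/-- **The segment integral.** `∫_p^q cosh(x/2)(α + βx) cos(xy) dx = [(α + βx) S(x,y) − β T(x,y)]_p^q`. [folklore] -/
theorem integral_cosh_affine_cos (α β y p q : ℝ) :
    ∫ x in p..q, Real.cosh (x / 2) * (α + β * x) * Real.cos (x * y) =
      ((α + β * q) * pwS q y - β * pwT q y) - ((α + β * p) * pwS p y - β * pwT p y) := by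
  have hderiv : ∀ x ∈ uIcc p q, HasDerivAt (fun x => (α + β * x) * pwS x y - β * pwT x y)
      (Real.cosh (x / 2) * (α + β * x) * Real.cos (x * y)) x := by
    intro x _hx
    have ha : HasDerivAt (fun x : ℝ => α + β * x) β x := by
      simpa using ((hasDerivAt_id x).const_mul β).const_add α
    have h := (ha.mul (hasDerivAt_pwS x y)).sub ((hasDerivAt_pwT x y).const_mul β)
    refine h.congr_deriv ?_
    ring
  have hint : IntervalIntegrable (fun x => Real.cosh (x / 2) * (α + β * x) * Real.cos (x * y)) volume p q :=
    (by fun_prop : Continuous fun x => Real.cosh (x / 2) * (α + β * x) * Real.cos (x * y)).intervalIntegrable _ _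
  exact integral_eq_sub_of_hasDerivAt hderiv hint

end Summit.RiemannHypothesis.RiemannHypothesis.Theorems.SignCone

end
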